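import Literature.RepresentationTheory.FiniteGroups.GL2ModularPrincipalSeriesLatticeTwistIndex
import Literature.RepresentationTheory.FiniteGroups.GL2ModularPrincipalSeriesLatticeUniqueSubrep
import Literature.RepresentationTheory.FiniteGroups.GL2ModularPrincipalSeriesLatticeTeichmuller
import Literature.NumberTheory.GaussSums.JacobiSumTeichmullerIntegralQuadratic
import Summits.BirchSwinnertonDyer.BirchSwinnertonDyer.Theorems.TeichmullerTwistDescentTwistedPeriodLatticeDichotomy
import HarnessLib

/-!
# Route `TeichmullerTwistDescent`, LINE 11 crux K `TwistedPeriodLatticeSaturation` (stmt-BirchSwinnertonDyer-25368):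
# «case one» `g·Λ(f⊗χ) ⊆ p·Λ(f)` is EXCLUDED by a tame-type lattice datum — the F″-free K-line composed

Cell `pub/bsd-wall` (D-0145 line route-BirchSwinnertonDyer-TeichmullerTwistDescent, OPEN rev 7), seat `bsd-line-ttd-p1`
(prover 1/2, g22).  THEOREMS ONLY (no definition, no named fact, no `sorry`).  BSD is not proved by this file;
Manin's conjecture is not proved; the crux K is NOT closed here: K is reduced (for every instance `(W, p, D, χ)` of
its binders, GRANTED the Modularity theorem `exists_isNewformOf` exactly as in the registered skeleton's
`stub_dichotomy`) to the existence of a TAME-TYPE LATTICE DATUM (the hypotheses `Λ'`, `hm`, `hsoc`, `βW`, `βV`,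
`hβW`, `hβV`, `hβ` below) — the typed content of the inputs (I1) automorphic type, (I2) transfer, (I3)–(I4) weights
in cohomology and (I6) Kodaira exponent of the audited mechanism (ttd-p1 g14 `MECHANISM-K-lattice`, g19
`AUDIT-K-MECHANISM` §1 (S1)–(S10), §4, §7; evidence on 25368).  Steps (S7) torus lines / Stickelberger, (S8) the
index computation and (I5) lattice uniqueness [EmertonGeeSavitt2015, Lemma 4.1.1] are the tree theorems this file
composes (`Literature/RepresentationTheory/FiniteGroups/GL2ModularPrincipalSeries{LatticeUniqueSubrep, TorusLines,
TwistOperator, CoordTwist, LatticeTwistIndex}`, `Literature/NumberTheory/GaussSums/JacobiSumTeichmullerIntegralQuadratic`).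

## The datum (hypotheses, in the tree's vocabulary)

`p` odd, `0 < b`, `2b < p − 1` (the UNSTARRED étale exponent; (I6): `b = (p−1)·ord_pΔ_min/12 ∈ {(p−1)/6, (p−1)/4,
(p−1)/3}` for Kodaira II, III, IV), `ω̃ = Kato2004.teichmullerChar p`, `χ₁ = ω̃^{p−1−b}`, `χ₂ = ω̃ᵇ` (the Q-side
lattice class `L₁ = Fun_{ℤ_p}(Ind(ω̃⁻ᵇ ⊗ ω̃ᵇ))` of the audit), `χ = ω̃^{(p−1)/2}` the quadratic character with values
in `ℤ_p`, a residue algebra `ℤ_p → k` onto a finite field factoring through `toZMod` (`hsurj`, `halg`);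
* `Λ'` — a `GL₂(𝔽_p)`-stable `ℤ_p`-submodule of FINITE INDEX (`hm`) of the Bruhat-coordinate model `coordRep χ₁ χ₂`
  (carrier `Option 𝔽_p → ℤ_p`) whose reduction has SOCLE `⊆ {Sym^{2b} ⊗ χ̄₁∘det}` (`hsoc`, verbatim the hypothesis of
  `subrepresentation_coordRep_eq_pow_smul_top`) — (I1)+(I3)+(I4): «`Λ_Q^±`, the `f_W`-part of
  `H¹(Y(K(p)K₀(M)), ℤ_p)_𝔪`, is rationally the type `Ind(ω̃⁻ᵇ ⊗ ω̃ᵇ)` and its reduction has socle the Serre weight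
  `C_W`»;
* `βW : Λ(f) →+ (Option 𝔽_p → ℤ_p)` with values in the `T`-invariants of `Λ'` (`hβW`) and
  `βV : Λ(f⊗χ) →+ (Option 𝔽_p → ℤ_p)` whose values `ℤ_p`-span a module containing the `χ∘det`-eigenvectors of `Λ'`
  (`hβV`), intertwining multiplication by the Gauss sum with the twisting operator:
  `βW(g·w) = T_χ(βV(w))` (`hβ`) — (I2): «`Q_W ⊗ ℤ_p = Λ_Q^{T̃}`, `Q_V ⊗ ℤ_p = Φ_χ(Λ_Q^{T̃,χ})`, `T_χ^{dn} = Φ_χ T_χ^{up}`».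

## What is proved

* `dvd_jacobiSum_of_typeLattice` — pure algebra over `ℤ_p`: for a lattice `Λ'` as above (any `χ₁, χ₂` with the
  hypotheses of the lattice theorem, `χ₁χ₂ = 1`, `χ` quadratic `∉ {χ₁, χ₂}`) and any set `S` of vectors spanning over
  the `χ∘det`-line of `Λ'` with `T_χ(S) ⊆ p·Λ'^T`: `p ∣ J(χ₂χ, χ)` (lattice uniqueness `Λ' = pᶜ·⊤` + the index
  statement `T_χ(Λ'^{T,χ∘det}) = J·Λ'^T`);
* `teichmuller_hypotheses` family (`reduceChar` relation/inequality, `χ₁χ₂ = 1`, `χ₁ ≠ 1`, `χ` quadratic, `χ ≠ χ₁, χ₂`)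
  for the Teichmüller exponents `(p−1−b, b)`;
* **`not_caseOne_of_typeLatticeDatum`** — for additive subgroups `Λf, Λfχ ⊆ ℂ` and `g ∈ ℂ` with `gΛfχ ⊆ Λf`, a datum
  as above, and «case one» `∀ w ∈ Λfχ, ∃ z ∈ Λf, g w = p z`: FALSE (the Jacobi sum `J(ω̃^{b+(p−1)/2}, ω̃^{(p−1)/2})` is a
  `p`-adic UNIT for `2b < p − 1` — Stickelberger — yet would be divisible by `p`);
* **`twistedPeriodLatticeSaturation_at_of_typeLatticeDatum`** — the conclusion of K at `(W, p, D, χ_ℂ)` (binders of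
  `TwistedPeriodLatticeSaturation` verbatim, `p ≥ 11`) from Modularity + a datum for `Λ(f_D)`, `Λ(f_D ⊗ χ_ℂ)`,
  `g = g(χ_ℂ)`: the registered `stub_dichotomy` (tree `stub_dichotomy_of_modularity`) leaves «K ∨ case one», and case
  one is excluded.

What this file does NOT supply: the datum itself ((I1)–(I4), (I6) are not in the tree: no `Y(K(p)K₀(M))`, no
`GL₂(𝔽_p)`-action on its cohomology, no weight theory); BSD / Manin / K / GE11 are not proved here.
-/

set_option autoImplicit false
-- single-conjunct summit: `Summit.BirchSwinnertonDyer.BirchSwinnertonDyer.…` repeats the name by design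
set_option linter.dupNamespace false

noncomputable section

open scoped Pointwise

open Function
open Literature.RepresentationTheory.FiniteGroups Literature.RepresentationTheory.FiniteGroups.GL2
  Literature.NumberTheory.GaussSums Literature.NumberTheory.EllipticCurves.ModularForms
open Literature.NumberTheory.EllipticCurves (Kato2004.teichmullerChar Kato2004.toZMod_teichmullerChar)

namespace Summit.BirchSwinnertonDyer.BirchSwinnertonDyer.Theorems.TeichmullerTwistDescent.TypeLatticeNoCaseOne

/-! ### §1 Pure algebra: a type lattice with small twist image forces `p ∣ J(χ₂χ, χ)` -/

section Algebra

variable (p : ℕ) [hp : Fact p.Prime] {k : Type} [Field k] [CharP k p] [Algebra ℤ_[p] k] [Finite k]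
  (χ₁ χ₂ : (ZMod p)ˣ →* ℤ_[p]ˣ) {r s : ℕ}

/-- **A stable lattice of the tame type whose `χ∘det`-line has `T_χ`-image in `p·(T-invariants)` forces
`p ∣ J(χ₂χ, χ)`.**  Hypotheses: the lattice theorem's (`hsurj`, `hχne`, `hχ`, `hrs`, `Λ'`, `hm`, `hsoc` verbatim as
in `subrepresentation_coordRep_eq_pow_smul_top` with `R = ℤ_p`, `ϖ = p`), the torus-line hypotheses (`χ₁χ₂ = 1`,
`χ₁ ≠ 1`, `χ` quadratic, `χ ∉ {χ₁, χ₂}`), and a set `S` with `Λ' ∩ 𝓑^{T,χ∘det} ⊆ span S`, `T_χ(S) ⊆ p·(Λ' ∩ 𝓑^T)`.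
Proof: `Λ' = pᶜ·⊤` (EGS Lemma 4.1.1 for the type), then the divisibility criterion of `…LatticeTwistIndex`.
[cite: EmertonGeeSavitt2015, Lemma 4.1.1] [cite: IrelandRosen1990, Ch. 8 §3 Thm. 1] -/
theorem dvd_jacobiSum_of_typeLattice (hsurj : Surjective (algebraMap ℤ_[p] k))
    (hχne : reduceChar k χ₁ ≠ reduceChar k χ₂)
    (hχ : ∀ a : (ZMod p)ˣ, (reduceChar k χ₂ a : k) = (reduceChar k χ₁ a : k) * ZMod.castHom (dvd_refl p) k a ^ r)
    (hrs : r + s = p - 1) (h12 : χ₁ * χ₂ = 1) (h1 : χ₁ ≠ 1) {χ : MulChar (ZMod p) ℤ_[p]} (hχq : χ⁻¹ = χ)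
    (hχ1 : χ ≠ MulChar.ofUnitHom χ₁) (hχ2 : χ ≠ MulChar.ofUnitHom χ₂)
    (Λ' : Subrepresentation (coordRep χ₁ χ₂)) {m : ℕ}
    (hm : ∀ v : Option (ZMod p) → ℤ_[p], (p : ℤ_[p]) ^ m • v ∈ Λ')
    (hsoc : ∀ N : Submodule ℤ_[p]
        (↥Λ'.toSubmodule ⧸ ((p : ℤ_[p]) • Λ'.toSubmodule).comap Λ'.toSubmodule.subtype),
      (∀ (g : GL (Fin 2) (ZMod p)) (x : ↥Λ'.toSubmodule), Submodule.Quotient.mk x ∈ N →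
        Submodule.Quotient.mk (⟨coordRep χ₁ χ₂ g x, Λ'.apply_mem_toSubmodule g x.2⟩ : ↥Λ'.toSubmodule) ∈ N) →
      N ≠ ⊥ →
      ∃ f : ↥(MvPolynomial.homogeneousSubmodule (Fin 2) k r) →ₗ[ℤ_[p]]
          (↥Λ'.toSubmodule ⧸ ((p : ℤ_[p]) • Λ'.toSubmodule).comap Λ'.toSubmodule.subtype),
        Injective f ∧ LinearMap.range f ≤ N ∧
        ∀ (g : GL (Fin 2) (ZMod p)) (φ : ↥(MvPolynomial.homogeneousSubmodule (Fin 2) k r)) (x : ↥Λ'.toSubmodule),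
          Submodule.Quotient.mk x = f φ →
          Submodule.Quotient.mk (⟨coordRep χ₁ χ₂ g x, Λ'.apply_mem_toSubmodule g x.2⟩ : ↥Λ'.toSubmodule) =
            f (symPowTwist (ZMod.castHom (dvd_refl p) k) (reduceChar k χ₁) r g φ))
    (S : Set (Option (ZMod p) → ℤ_[p]))
    (hS : Λ'.toSubmodule ⊓ coordTorusEigenspace χ₁ χ₂ (fun a b : (ZMod p)ˣ => χ (a : ZMod p) * χ (b : ZMod p)) ≤
      Submodule.span ℤ_[p] S)
    (hT : ∀ v ∈ S, coordTwistOp χ₁ χ₂ χ v ∈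
      (p : ℤ_[p]) • (Λ'.toSubmodule ⊓ coordTorusEigenspace χ₁ χ₂ (fun _ _ => (1 : ℤ_[p])))) :
    (p : ℤ_[p]) ∣ jacobiSum (MulChar.ofUnitHom χ₂ * χ) χ := by
  obtain ⟨c, hc⟩ := subrepresentation_coordRep_eq_pow_smul_top p χ₁ χ₂ (ϖ := (p : ℤ_[p])) (NeZero.ne _)
    (padicInt_eq_zero_of_forall_pow_dvd p)
    (padicInt_algebraMap_eq_zero_iff p (padicInt_ker_eq_maximalIdeal p hsurj)) hsurj hχne hχ hrs Λ' hm hsoc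
  rw [hc] at hS hT
  exact dvd_jacobiSum_of_span_le_of_map_mem χ₁ χ₂ h12 h1 hχq hχ1 hχ2 (pow_ne_zero c (NeZero.ne _)) (p : ℤ_[p]) S
    hS hT

end Algebra

/-! ### §2 The Teichmüller exponents `(p − 1 − b, b)` with `0 < b`, `2b < p − 1` -/

section Teichmuller

variable (p : ℕ) [hp : Fact p.Prime] {k : Type} [Field k] [CharP k p] [Algebra ℤ_[p] k]

/-- `χ̄₂ = χ̄₁ · ε^{2b}` for `(χ₁, χ₂) = (ω̃^{p−1−b}, ω̃ᵇ)`: `ε(a)^{p−1−b} ε(a)^{2b} = ε(a)^{p−1} ε(a)ᵇ = ε(a)ᵇ`.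
[cite: EmertonGeeSavitt2015, §3.2] -/
theorem reduceChar_rel_of_exponents
    (halg : ∀ x : ℤ_[p], algebraMap ℤ_[p] k x = ZMod.castHom (dvd_refl p) k (PadicInt.toZMod x)) {b : ℕ}
    (hb : b ≤ p - 1) (a : (ZMod p)ˣ) :
    (reduceChar k (Kato2004.teichmullerChar p ^ b) a : k) =
      (reduceChar k (Kato2004.teichmullerChar p ^ (p - 1 - b)) a : k) * ZMod.castHom (dvd_refl p) k a ^ (2 * b) := by
  have hc : ZMod.castHom (dvd_refl p) k (a : ZMod p) ^ (p - 1) = 1 := by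
    rw [← map_pow, ZMod.pow_card_sub_one_eq_one a.ne_zero, map_one]
  rw [coe_reduceChar_teichmullerChar_pow p halg, coe_reduceChar_teichmullerChar_pow p halg, ← pow_add,
    show p - 1 - b + 2 * b = (p - 1) + b by omega, pow_add, hc, one_mul]

/-- `χ̄₁ ≠ χ̄₂` for `(χ₁, χ₂) = (ω̃^{p−1−b}, ω̃ᵇ)`, `0 < b`, `2b < p − 1` (over a field of characteristic `p`).
[cite: EmertonGeeSavitt2015, §3.2] -/
theorem reduceChar_ne_of_exponents
    (halg : ∀ x : ℤ_[p], algebraMap ℤ_[p] k x = ZMod.castHom (dvd_refl p) k (PadicInt.toZMod x)) {b : ℕ}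
    (hb : 0 < b) (hb2 : 2 * b < p - 1) :
    reduceChar k (Kato2004.teichmullerChar p ^ (p - 1 - b)) ≠ reduceChar k (Kato2004.teichmullerChar p ^ b) :=
  (reduceChar_teichmullerChar_pow_ne p halg (i := b) (j := p - 1 - b) (r := p - 1 - 2 * b) (by omega) (by omega)
    (by omega)).symm

/-- `ω̃^{p−1−b} · ω̃ᵇ = 1` (trivial central character). [cite: Lang1990, Ch. 1 §2] -/
theorem teichmullerChar_pow_mul_pow_eq_one {b : ℕ} (hb : b ≤ p - 1) :
    Kato2004.teichmullerChar p ^ (p - 1 - b) * Kato2004.teichmullerChar p ^ b = 1 := by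
  rw [← teichmullerChar_pow_add, Nat.sub_add_cancel hb, teichmullerChar_pow_card_sub_one]

/-- `ω̃^{p−1−b} ≠ 1` for `0 < b < p − 1`. [cite: Lang1990, Ch. 1 §2] -/
theorem teichmullerChar_pow_sub_ne_one {b : ℕ} (hb : 0 < b) (hb' : b < p - 1) :
    Kato2004.teichmullerChar p ^ (p - 1 - b) ≠ 1 :=
  teichmullerChar_pow_ne_one p (by omega) (by omega)

/-- The quadratic character `ω̃^{(p−1)/2}` differs from `ω̃^{p−1−b}` and from `ω̃ᵇ` when `2b < p − 1` (`p` odd, `0 < b`).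
[cite: Lang1990, Ch. 1 §2] -/
theorem quadratic_ne_of_exponents (hp2 : p ≠ 2) {b : ℕ} (hb : 0 < b) (hb2 : 2 * b < p - 1) :
    MulChar.ofUnitHom (Kato2004.teichmullerChar p ^ ((p - 1) / 2)) ≠
        MulChar.ofUnitHom (Kato2004.teichmullerChar p ^ (p - 1 - b)) ∧
      MulChar.ofUnitHom (Kato2004.teichmullerChar p ^ ((p - 1) / 2)) ≠
        MulChar.ofUnitHom (Kato2004.teichmullerChar p ^ b) := by
  have heven : 2 * ((p - 1) / 2) = p - 1 := Nat.two_mul_div_two_of_even (hp.out.even_sub_one hp2)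
  refine ⟨fun h => ?_, fun h => ?_⟩
  · have := ofUnitHom_teichmullerChar_pow_injOn p (by omega) (by omega) h
    omega
  · have := ofUnitHom_teichmullerChar_pow_injOn p (by omega) (by omega) h
    omega

end Teichmuller

/-! ### §3 «Case one» is excluded by a tame-type lattice datum -/

section NoCaseOne

variable (p : ℕ) [hp : Fact p.Prime] {k : Type} [Field k] [CharP k p] [Algebra ℤ_[p] k] [Finite k]

/-- **«Case one» `g·Λfχ ⊆ p·Λf` contradicts a tame-type lattice datum.**  Data: `p` odd, `0 < b`, `2b < p − 1`
(unstarred exponent), `χ₁ = ω̃^{p−1−b}`, `χ₂ = ω̃ᵇ`, `χ = ω̃^{(p−1)/2}`; a residue field `ℤ_p → k` through `toZMod`;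
a `GL₂(𝔽_p)`-stable `ℤ_p`-lattice `Λ'` of finite index in `coordRep χ₁ χ₂` with reduction socle `⊆ {Sym^{2b} ⊗ χ̄₁det}`;
additive subgroups `Λf, Λfχ ⊆ ℂ`, `g ∈ ℂ` with `gΛfχ ⊆ Λf`; additive maps `βW : Λf → ℤ_p^{ℙ¹}` into the `T`-invariants
of `Λ'` and `βV : Λfχ → ℤ_p^{ℙ¹}` whose image spans over the `χ∘det`-line of `Λ'`, with `βW(g w) = T_χ(βV w)`.
Then `∀ w ∈ Λfχ, ∃ z ∈ Λf, g w = p z` is impossible: it would give `T_χ(βV w) = p·βW(z) ∈ pΛ'^T`, hence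
`p ∣ J(ω̃^{b+(p−1)/2}, ω̃^{(p−1)/2})` by `dvd_jacobiSum_of_typeLattice`, whereas that Jacobi sum is a `p`-adic unit
(Stickelberger, `isUnit_jacobiSum_teichmuller_quadratic_of_two_mul_lt`).  This is steps (S7)–(S8) + (I5) of the
audited K-mechanism composed; the datum is (I1)–(I4), (I6).
[cite: EmertonGeeSavitt2015, Lemma 4.1.1] [cite: Lang1990, Ch. 1 §2 Thm. 2.1] [cite: IrelandRosen1990, Ch. 8 §3 Thm. 1] -/
theorem not_caseOne_of_typeLatticeDatum (hp2 : p ≠ 2) {b : ℕ} (hb : 0 < b) (hb2 : 2 * b < p - 1)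
    (hsurj : Surjective (algebraMap ℤ_[p] k))
    (halg : ∀ x : ℤ_[p], algebraMap ℤ_[p] k x = ZMod.castHom (dvd_refl p) k (PadicInt.toZMod x))
    (Λ' : Subrepresentation
      (coordRep (Kato2004.teichmullerChar p ^ (p - 1 - b)) (Kato2004.teichmullerChar p ^ b))) {m : ℕ}
    (hm : ∀ v : Option (ZMod p) → ℤ_[p], (p : ℤ_[p]) ^ m • v ∈ Λ')
    (hsoc : ∀ N : Submodule ℤ_[p]
        (↥Λ'.toSubmodule ⧸ ((p : ℤ_[p]) • Λ'.toSubmodule).comap Λ'.toSubmodule.subtype),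
      (∀ (g : GL (Fin 2) (ZMod p)) (x : ↥Λ'.toSubmodule), Submodule.Quotient.mk x ∈ N →
        Submodule.Quotient.mk (⟨coordRep (Kato2004.teichmullerChar p ^ (p - 1 - b)) (Kato2004.teichmullerChar p ^ b)
          g x, Λ'.apply_mem_toSubmodule g x.2⟩ : ↥Λ'.toSubmodule) ∈ N) →
      N ≠ ⊥ →
      ∃ f : ↥(MvPolynomial.homogeneousSubmodule (Fin 2) k (2 * b)) →ₗ[ℤ_[p]]
          (↥Λ'.toSubmodule ⧸ ((p : ℤ_[p]) • Λ'.toSubmodule).comap Λ'.toSubmodule.subtype),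
        Injective f ∧ LinearMap.range f ≤ N ∧
        ∀ (g : GL (Fin 2) (ZMod p)) (φ : ↥(MvPolynomial.homogeneousSubmodule (Fin 2) k (2 * b)))
          (x : ↥Λ'.toSubmodule),
          Submodule.Quotient.mk x = f φ →
          Submodule.Quotient.mk (⟨coordRep (Kato2004.teichmullerChar p ^ (p - 1 - b)) (Kato2004.teichmullerChar p ^ b)
            g x, Λ'.apply_mem_toSubmodule g x.2⟩ : ↥Λ'.toSubmodule) =
            f (symPowTwist (ZMod.castHom (dvd_refl p) k)
              (reduceChar k (Kato2004.teichmullerChar p ^ (p - 1 - b))) (2 * b) g φ))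
    {Λf Λfχ : AddSubgroup ℂ} (g : ℂ) (hframe : ∀ w ∈ Λfχ, g * w ∈ Λf)
    (βW : Λf →+ (Option (ZMod p) → ℤ_[p])) (βV : Λfχ →+ (Option (ZMod p) → ℤ_[p]))
    (hβW : ∀ z : Λf, βW z ∈ Λ'.toSubmodule ⊓
      coordTorusEigenspace (Kato2004.teichmullerChar p ^ (p - 1 - b)) (Kato2004.teichmullerChar p ^ b)
        (fun _ _ => (1 : ℤ_[p])))
    (hβV : Λ'.toSubmodule ⊓
        coordTorusEigenspace (Kato2004.teichmullerChar p ^ (p - 1 - b)) (Kato2004.teichmullerChar p ^ b)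
          (fun a c : (ZMod p)ˣ => MulChar.ofUnitHom (Kato2004.teichmullerChar p ^ ((p - 1) / 2)) (a : ZMod p) *
            MulChar.ofUnitHom (Kato2004.teichmullerChar p ^ ((p - 1) / 2)) (c : ZMod p)) ≤
      Submodule.span ℤ_[p] (Set.range βV))
    (hβ : ∀ (w : ℂ) (hw : w ∈ Λfχ), βW ⟨g * w, hframe w hw⟩ =
      coordTwistOp (Kato2004.teichmullerChar p ^ (p - 1 - b)) (Kato2004.teichmullerChar p ^ b)
        (MulChar.ofUnitHom (Kato2004.teichmullerChar p ^ ((p - 1) / 2))) (βV ⟨w, hw⟩))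
    (hcase : ∀ w ∈ Λfχ, ∃ z ∈ Λf, g * w = (p : ℂ) * z) : False := by
  have hne := quadratic_ne_of_exponents p hp2 hb hb2
  -- the divisibility from the lattice datum
  have hdvd : (p : ℤ_[p]) ∣ jacobiSum (MulChar.ofUnitHom (Kato2004.teichmullerChar p ^ b) *
      MulChar.ofUnitHom (Kato2004.teichmullerChar p ^ ((p - 1) / 2)))
      (MulChar.ofUnitHom (Kato2004.teichmullerChar p ^ ((p - 1) / 2))) := by
    refine dvd_jacobiSum_of_typeLattice p (Kato2004.teichmullerChar p ^ (p - 1 - b)) (Kato2004.teichmullerChar p ^ b)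
      hsurj (reduceChar_ne_of_exponents p halg hb hb2)
      (reduceChar_rel_of_exponents p halg (by omega)) (s := p - 1 - 2 * b) (by omega)
      (teichmullerChar_pow_mul_pow_eq_one p (by omega)) (teichmullerChar_pow_sub_ne_one p hb (by omega))
      (ofUnitHom_teichmullerChar_pow_half_inv p hp2) hne.1 hne.2 Λ' hm hsoc (Set.range βV) hβV ?_
    rintro _ ⟨⟨w, hw⟩, rfl⟩
    obtain ⟨z, hz, hgw⟩ := hcase w hw
    have hgz : (⟨g * w, hframe w hw⟩ : Λf) = (p : ℕ) • (⟨z, hz⟩ : Λf) := by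
      apply Subtype.ext
      show g * w = (((p : ℕ) • (⟨z, hz⟩ : Λf) : Λf) : ℂ)
      rw [AddSubgroupClass.coe_nsmul, nsmul_eq_mul, hgw]
    rw [← hβ w hw, hgz, map_nsmul, ← Nat.cast_smul_eq_nsmul ℤ_[p]]
    exact Submodule.smul_mem_pointwise_smul _ _ _ (hβW ⟨z, hz⟩)
  -- but the Jacobi sum is a unit (Stickelberger, unstarred exponent)
  have hunit := isUnit_jacobiSum_teichmuller_quadratic_of_two_mul_lt p hp2 hb hb2
  exact (PadicInt.irreducible_p (p := p)).not_isUnit (isUnit_of_dvd_unit hdvd hunit)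

end NoCaseOne

/-! ### §4 The conclusion of K at `(W, p, D, χ)` from Modularity and a datum -/

section K

open WeierstrassCurve Literature.NumberTheory.EllipticCurves
  Summit.BirchSwinnertonDyer.BirchSwinnertonDyer.Theorems.TeichmullerTwistDescent.TwistedPeriodLatticeDichotomy

variable (p : ℕ) [hp : Fact p.Prime] {k : Type} [Field k] [CharP k p] [Algebra ℤ_[p] k] [Finite k]

/-- **K at `(W, p, D, χ)` from the Modularity theorem and a tame-type lattice datum.**  Binders of the crux
`TwistedPeriodLatticeSaturation` (stmt-BirchSwinnertonDyer-25368) verbatim (`p ≥ 11`, additive potentially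
good ordinary, `ord_pΔ_min ≤ 4`, `E[p]` irreducible, `D` lattice-optimal at conductor level, `χ` primitive quadratic
mod `p`), the Modularity theorem `exists_isNewformOf` (as in the registered `stub_dichotomy`), and a tame-type
lattice datum (`not_caseOne_of_typeLatticeDatum`) for `Λf = Λ(f_D)`, `Λfχ = Λ(f_D ⊗ χ)`, `g = g(χ)`:
then `Λ(f_D) ⊆ g(χ)·Λ(f_D ⊗ χ)`.  Proof: the tree's `stub_dichotomy_of_modularity` leaves K or «case one»
`g(χ)Λ(f_D⊗χ) ⊆ pΛ(f_D)`, and case one is excluded by the datum (frame inclusion `gΛ(f⊗χ) ⊆ Λ(f)` = Stevens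
(5.4), tree `gaussSum_mul_mem_periodLattice_of_mem_charTwist`).  K itself (for ALL its instances) is this theorem
GRANTED a datum at every instance — the typed content of the carriers (I1)–(I4), (I6), not in the tree.
[cite: EdixhovenManin1991, §4] [cite: EmertonGeeSavitt2015, Lemma 4.1.1] [cite: Stevens1989, Lemma (5.4) p. 97] -/
theorem twistedPeriodLatticeSaturation_at_of_typeLatticeDatum (hnf : ModularForms.exists_isNewformOf)
    (W : WeierstrassCurve ℚ) [W.IsElliptic] [W.IsGloballyMinimal] [NeZero (W.conductorNorm ℤ)]
    (D : ModularForms.ModularParametrizationData W (W.conductorNorm ℤ)) (hsq : p ^ 2 ∣ W.conductorNorm ℤ)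
    (hp11 : 11 ≤ p) (hadd : Rank1Residual.Addv W p) (hirr : Rank1Residual.Irr W p)
    (hGo : Summit.BirchSwinnertonDyer.Rank1Residual.Additive.TypeGOrd W p)
    (hV4 : padicValInt p W.minimalDiscriminantInt ≤ 4)
    (hopt : ∀ z ∈ D.L.lattice, ∃ w ∈ ModularForms.periodLattice D.f, z = D.c * w)
    (χ : DirichletCharacter ℂ p) (hχ : χ.IsQuadratic) (hprim : χ.IsPrimitive)
    {b : ℕ} (hb : 0 < b) (hb2 : 2 * b < p - 1)
    (hsurj : Surjective (algebraMap ℤ_[p] k))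
    (halg : ∀ x : ℤ_[p], algebraMap ℤ_[p] k x = ZMod.castHom (dvd_refl p) k (PadicInt.toZMod x))
    (Λ' : Subrepresentation
      (coordRep (Kato2004.teichmullerChar p ^ (p - 1 - b)) (Kato2004.teichmullerChar p ^ b))) {m : ℕ}
    (hm : ∀ v : Option (ZMod p) → ℤ_[p], (p : ℤ_[p]) ^ m • v ∈ Λ')
    (hsoc : ∀ N : Submodule ℤ_[p]
        (↥Λ'.toSubmodule ⧸ ((p : ℤ_[p]) • Λ'.toSubmodule).comap Λ'.toSubmodule.subtype),
      (∀ (g : GL (Fin 2) (ZMod p)) (x : ↥Λ'.toSubmodule), Submodule.Quotient.mk x ∈ N →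
        Submodule.Quotient.mk (⟨coordRep (Kato2004.teichmullerChar p ^ (p - 1 - b)) (Kato2004.teichmullerChar p ^ b)
          g x, Λ'.apply_mem_toSubmodule g x.2⟩ : ↥Λ'.toSubmodule) ∈ N) →
      N ≠ ⊥ →
      ∃ f : ↥(MvPolynomial.homogeneousSubmodule (Fin 2) k (2 * b)) →ₗ[ℤ_[p]]
          (↥Λ'.toSubmodule ⧸ ((p : ℤ_[p]) • Λ'.toSubmodule).comap Λ'.toSubmodule.subtype),
        Injective f ∧ LinearMap.range f ≤ N ∧
        ∀ (g : GL (Fin 2) (ZMod p)) (φ : ↥(MvPolynomial.homogeneousSubmodule (Fin 2) k (2 * b)))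
          (x : ↥Λ'.toSubmodule),
          Submodule.Quotient.mk x = f φ →
          Submodule.Quotient.mk (⟨coordRep (Kato2004.teichmullerChar p ^ (p - 1 - b)) (Kato2004.teichmullerChar p ^ b)
            g x, Λ'.apply_mem_toSubmodule g x.2⟩ : ↥Λ'.toSubmodule) =
            f (symPowTwist (ZMod.castHom (dvd_refl p) k)
              (reduceChar k (Kato2004.teichmullerChar p ^ (p - 1 - b))) (2 * b) g φ))
    (βW : ModularForms.periodLattice D.f →+ (Option (ZMod p) → ℤ_[p]))
    (βV : ModularForms.periodLattice
        (ModularForms.charTwist (W.conductorNorm ℤ) (dvd_refl _) hsq hχ D.f) →+ (Option (ZMod p) → ℤ_[p]))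
    (hβW : ∀ z : ModularForms.periodLattice D.f, βW z ∈ Λ'.toSubmodule ⊓
      coordTorusEigenspace (Kato2004.teichmullerChar p ^ (p - 1 - b)) (Kato2004.teichmullerChar p ^ b)
        (fun _ _ => (1 : ℤ_[p])))
    (hβV : Λ'.toSubmodule ⊓
        coordTorusEigenspace (Kato2004.teichmullerChar p ^ (p - 1 - b)) (Kato2004.teichmullerChar p ^ b)
          (fun a c : (ZMod p)ˣ => MulChar.ofUnitHom (Kato2004.teichmullerChar p ^ ((p - 1) / 2)) (a : ZMod p) *
            MulChar.ofUnitHom (Kato2004.teichmullerChar p ^ ((p - 1) / 2)) (c : ZMod p)) ≤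
      Submodule.span ℤ_[p] (Set.range βV))
    (hβ : ∀ (w : ℂ) (hw : w ∈ ModularForms.periodLattice
        (ModularForms.charTwist (W.conductorNorm ℤ) (dvd_refl _) hsq hχ D.f)),
      βW ⟨gaussSum χ (ZMod.stdAddChar (N := p)) * w,
          ModularForms.gaussSum_mul_mem_periodLattice_of_mem_charTwist (W.conductorNorm ℤ) (dvd_refl _) hsq hχ
            hprim D.f hw⟩ =
        coordTwistOp (Kato2004.teichmullerChar p ^ (p - 1 - b)) (Kato2004.teichmullerChar p ^ b)
          (MulChar.ofUnitHom (Kato2004.teichmullerChar p ^ ((p - 1) / 2))) (βV ⟨w, hw⟩)) :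
    ∀ z ∈ ModularForms.periodLattice D.f, ∃ w ∈ ModularForms.periodLattice
        (ModularForms.charTwist (W.conductorNorm ℤ) (dvd_refl _) hsq hχ D.f),
      z = gaussSum χ (ZMod.stdAddChar (N := p)) * w := by
  rcases stub_dichotomy_of_modularity hnf W p D hsq hp11 hadd hirr hGo hV4 hopt χ hχ hprim with h | hcase
  · exact h
  · exact (not_caseOne_of_typeLatticeDatum p (by omega) hb hb2 hsurj halg Λ' hm hsoc
      (gaussSum χ (ZMod.stdAddChar (N := p)))
      (fun w hw => ModularForms.gaussSum_mul_mem_periodLattice_of_mem_charTwist (W.conductorNorm ℤ) (dvd_refl _)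
        hsq hχ hprim D.f hw)
      βW βV hβW hβV hβ hcase).elim

end K

end Summit.BirchSwinnertonDyer.BirchSwinnertonDyer.Theorems.TeichmullerTwistDescent.TypeLatticeNoCaseOne
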